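import Mathlib
import Literature.NumberTheory.LFunctions.VinogradovZetaSumEstimate
import Summits.HodgeConjecture.FermatCycles.HodgeFermatHypUDefs
import Summits.HodgeConjecture.FermatCycles.HodgeFermatHypVTailC

/-!
# HypUTailQ — the tail of HYPOTHESIS U for `N > 3·10⁴`, part 1: the prime staircase and the many-factor regime (`HodgeFermat/HypUTailQ.lean`; HF-G24)

Tree copy (part 1 of 2) of the module `HodgeFermat/HypUTailQ.lean` of the sibling cell's standalone package
`run/shared/lean/pub/pub-hodgefermat/lean/HodgeFermat/` (528 lines, sha256 `eaead9b7c278c17a…`), source lines 31–269 (§1 the prime staircase `qt`, `Dmin`, `bnd`, `bnd_lt_one`; §2 the many-factor regime).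
Filed by cell `pub-hfermat`, seat prover-1 gen-3, on the COORDINATOR KEEPER RULING of 2026-08-25 (gem sweep H1: take the
off-gate kernel theorem `thmFstar` through the gate) — here THEOREM F* of `tables/DPRIME-THEOREM.md` §9 IN FULL, i.e.
PROPOSITION D′(3N) and the descent (`HodgeFermat/PropDPrimeNFinal.lean`, GATE HF-G34), the last off-gate form of THEOREM F*
(its first two forms, `DecodingFinal.thmFstar` = F* at the prime levels and `ThmFstarNFinal.thmFstar` = F*(3N), landed on
2026-08-25 as `HodgeFermatThmFstar.lean` / `HodgeFermatThmFstarN.lean`, seats prover-1 gen-0 / gen-2); this file is one link of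
the import closure of `PropDPrimeNFinal.propDprime` (the sibling's KR-free chain: THEOREM L, COROLLARY M, THEOREM D6,
THEOREM U⁺, THEOREM KR6, THEOREM Z3U) on top of those landed chains.  The source module is the sibling's hub-checked module of
record (pub-hodgefermat `CERT.md` l.903, GATE HF-G24; cell record `check/HypUTailQ_standalone.lean` sha256 `bf0d7c48317cb99d…`); its declarations are copied VERBATIM.
Deviations from the source module, exhaustively: the `import` lines (tree modules `Summits.HodgeConjecture.FermatCycles.
HodgeFermat*` instead of `HodgeFermat.*`); this module docstring; DEDUP (pre-empting the gate's `dedup.landed`): five generic lemmas of the source restate VERBATIM lemmas that the sibling's later module `HypVTail.lean` copied from it and that landed first (`HodgeFermatHypVTailA/B/C.lean`, 2026-08-25): `foldr_min_le_mem` (l.101–108), `le_foldr_min` (l.110–116), `sum_range_eq_list` (l.199–201) [part 1], `log_le_orderOf` (l.320–362), `list_sum_map_range` (l.381–388) [part 2] — DELETED and re-bound by the added line `open HodgeFermat.KRFree.HypVTail (foldr_min_le_mem le_foldr_min sum_range_eq_list log_le_orderOf list_sum_map_range)` (extra import `HodgeFermatHypVTailC`); likewise `harmonic_cast_le` (l.214–219)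 restates `Literature.NumberTheory.LFunctions.VKZeta.sum_range_inv_succ_le'` and is DELETED, re-bound by `open Literature.NumberTheory.LFunctions.VKZeta renaming sum_range_inv_succ_le' → harmonic_cast_le` (extra import); every use site stays byte-identical (`qt`, `qt_step` etc. are this module's own and stay); one-line docstrings added (gate lint) to `qt_ge`, `foldr_min_le_init`, `E_eq_zero`, `bnd_cast`, `log_le_lin`; the file ends at source l.269 with an `end` line (part 2 = `HodgeFermatHypUTailQB.lean`).
Every other line — in particular every declaration's statement and proof — is byte-identical to the source.
HONEST FRAMING: explicit algebraic cycles for specific Hodge classes on Fermat/Delsarte varieties; residual open instances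
listed; no claim on general Hodge.  (This file is arithmetic of CM types / finite combinatorics / analytic number theory
of the sibling's KR-free programme; it claims nothing about cycles.)

The source module's docstring (HypUTailQ.lean l.6–29), verbatim:

## HypUTailQ — the tail of HYPOTHESIS U for N > 3·10⁴ (generation 24, HF-G24)

`uTail : UTail 30000`: for every squarefree `N > 30000` prime to 6,
`6 * ∑ p ∈ N.primeFactors, tau N p < φ(N)`.  This is generation 23's `HypUTail.uTail : UTail 1000000`
(second addendum HF-G23e) with the threshold lowered from `10⁶` to `3·10⁴` by ONE sharpening: the `i`-th
smallest prime factor of `N` (from `0`) is at least the `i`-th prime `≥ 5` — `5, 7, 11, 13, 17, …, 97`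
for `i ≤ 22` (table `qtab`, justified by a kernel check that the gaps of the table contain no prime),
instead of the crude `2 i + 5`.  With it the finite range to be certified shrinks from `10⁶` to `3·10⁴`,
small enough for the certificate-free kernel walk of `HypUAuto.lean` inside ONE hub file together with the
whole analytic chain (`D6OneFile`).

The argument (otherwise verbatim from `HypUTail.lean`):
* `tau N p ≤ φ(N/p) / ord_{N/p}(p)` and `φ(N) = (p-1) φ(N/p)`, so it suffices that
  `∑_{p ∣ N} 6 / ((p-1) · ord_{N/p}(p)) < 1`;
* `ord_{N/p}(p) ≥ ⌊log_p N⌋ ≥ max (⌊log_p 30000⌋, #{q ∣ N prime : q ≥ p})`;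
* listing the prime factors increasingly, the `i`-th is `≥ qt i` and has at least `k - i` prime factors
  above or equal to it;
* NUMERIC LEMMA `key`: for naturals `p_i ≥ qt i` and `d_i ≥ max (⌊log_{p_i} 30000⌋, k - i)`,
  `∑_{i<k} 6 / ((p_i - 1) d_i) < 1` — for `k < 24` by a kernel evaluation (`decide +kernel`) of the
  rational table `bnd` of band minima `Dmin` (maximum `0.98995…` at `k = 6`:
  `6/24 + 6/30 + 6/40 + 6/39 + 6/48 + 6/54`), for `k ≥ 24` by `(p_i - 1) d_i ≥ (2 i + 4)(k - i)`,
  partial fractions and `H_n ≤ 1 + log n`.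
-/

namespace HodgeFermat.KRFree.HypUTailQ

open Finset HodgeFermat.KRFree.HypBReduction

open HodgeFermat.KRFree.HypVTail (foldr_min_le_mem le_foldr_min sum_range_eq_list log_le_orderOf list_sum_map_range)
open Literature.NumberTheory.LFunctions.VKZeta renaming sum_range_inv_succ_le' → harmonic_cast_le

/-! ## §1 Band minima and the finite table -/

/-- `E p = ⌊log_p 30000⌋`. -/
def E (p : ℕ) : ℕ := Nat.log p 30000

/-- The points where `E` drops (bands `[5,6) [6,8) [8,14) [14,32) [32,174) [174,30001) [30001,∞)`
carry `E = 6,5,4,3,2,1,0`). -/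
def starts : List ℕ := [6, 8, 14, 32, 174, 30001]

/-- The `i`-th prime `≥ 5`, `i ≤ 22`. -/
def qtab : List ℕ := [5, 7, 11, 13, 17, 19, 23, 29, 31, 37, 41, 43, 47, 53, 59, 61, 67, 71, 73, 79, 83, 89, 97]

/-- lower bound for the `i`-th smallest prime factor (from `0`) of a number prime to `6`:
the table for `i ≤ 22`, `2 i + 5` beyond. -/
def qt (i : ℕ) : ℕ := qtab.getD i (2 * i + 5)

/-- `qt i ≥ 2i + 5` -/
theorem qt_ge (i : ℕ) : 2 * i + 5 ≤ qt i := by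
  by_cases hi : i < 23
  · unfold qt qtab; interval_cases i <;> decide
  · unfold qt
    rw [List.getD_eq_default _ _ (by unfold qtab; simp; omega)]

/-- kernel check: every number strictly inside a gap of the table has a divisor among `2, 3, 5, 7`
smaller than itself (so it is not prime). -/
theorem qtab_gaps : ∀ i, i < 22 → ∀ s, s < 98 → qt i < s → s < qt (i + 1) →
    [2, 3, 5, 7].any (fun d => Nat.blt d s && (s % d == 0)) = true := by
  decide +kernel

/-- the table step: a prime above the `i`-th bound is at least the `(i+1)`-st bound
(`r`, `s` odd with `r < s`). -/
theorem qt_step (i r s : ℕ) (hr : qt i ≤ r) (hrs : r < s) (hro : r % 2 = 1) (hso : s % 2 = 1)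
    (hs : s.Prime) : qt (i + 1) ≤ s := by
  by_cases hi : i < 22
  · by_contra hlt
    push Not at hlt
    have hq1 : qt (i + 1) ≤ 97 := by
      unfold qt qtab; interval_cases i <;> decide
    have hgap := qtab_gaps i hi s (by omega) (by omega) hlt
    simp only [List.any_cons, List.any_nil, Bool.or_false, Bool.or_eq_true, Bool.and_eq_true,
      Nat.blt_eq, beq_iff_eq] at hgap
    have key : ∀ d, d < s → s % d = 0 → 2 ≤ d → False := by
      intro d hds hmod hd2
      have hdvd : d ∣ s := Nat.dvd_of_mod_eq_zero hmod
      rcases (Nat.dvd_prime hs).mp hdvd with h | h <;> omega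
    rcases hgap with ⟨h1, h2⟩ | ⟨h1, h2⟩ | ⟨h1, h2⟩ | ⟨h1, h2⟩
    · exact key 2 h1 h2 le_rfl
    · exact key 3 h1 h2 (by omega)
    · exact key 5 h1 h2 (by omega)
    · exact key 7 h1 h2 (by omega)
  · have h1 : qt (i + 1) = 2 * (i + 1) + 5 := by
      unfold qt
      rw [List.getD_eq_default _ _ (by unfold qtab; simp; omega)]
    have h2 := qt_ge i
    omega

/-- value of the candidate `c` for the exponent floor `m`: `(c-1) · max (E c) m`. -/
def cval (m c : ℕ) : ℕ := (c - 1) * max (E c) m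

/-- A lower bound for `(p-1) · max (E p) m` over all `p ≥ q` (proved in `den_ge`). -/
def Dmin (q m : ℕ) : ℕ := ((starts.filter (fun c => q < c)).map (cval m)).foldr min (cval m q)

/-- `foldr min a l ≤ a` -/
theorem foldr_min_le_init (l : List ℕ) (a : ℕ) : l.foldr min a ≤ a := by
  induction l with
  | nil => simp
  | cons x l ih => simp only [List.foldr_cons]; exact le_trans (min_le_right _ _) ih


/-- every candidate is `≥ q`, so `Dmin q m ≥ (q-1) m`. -/
theorem Dmin_ge (q m : ℕ) : (q - 1) * m ≤ Dmin q m := by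
  unfold Dmin
  apply le_foldr_min
  · unfold cval; exact Nat.mul_le_mul le_rfl (le_max_right _ _)
  · intro x hx
    simp only [List.mem_map, List.mem_filter, decide_eq_true_eq] at hx
    obtain ⟨c, ⟨-, hqc⟩, rfl⟩ := hx
    unfold cval
    exact Nat.mul_le_mul (by omega) (le_max_right _ _)

/-- `E` is constant on a band. -/
theorem E_eq_of_band {b b' e p : ℕ} (h1 : (b' - 1) ^ e ≤ 30000) (h2 : 30000 < b ^ (e + 1))
    (hb : b ≤ p) (hb' : p < b') (hp : 1 < p) : E p = e := by
  unfold E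
  rw [Nat.log_eq_iff (Or.inr ⟨hp, by norm_num⟩)]
  constructor
  · exact le_trans (Nat.pow_le_pow_left (by omega) e) h1
  · exact lt_of_lt_of_le h2 (Nat.pow_le_pow_left hb (e + 1))

/-- the exponent table `E` vanishes beyond `30000` -/
theorem E_eq_zero {p : ℕ} (hp : 30001 ≤ p) : E p = 0 := by
  unfold E; exact Nat.log_of_lt (by omega)

/-- the band step of `den_ge`. -/
theorem den_ge_of_band (q m p b e : ℕ) (hEp : E p = e) (hEb : E b = e) (hEq : b ≤ q → E q = e)
    (hbp : b ≤ p) (hqp : q ≤ p) (hstart : b ≤ q ∨ b ∈ starts) :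
    Dmin q m ≤ (p - 1) * max (E p) m := by
  rw [hEp]
  by_cases hbq : b ≤ q
  · calc Dmin q m ≤ cval m q := foldr_min_le_init _ _
      _ = (q - 1) * max e m := by rw [cval, hEq hbq]
      _ ≤ (p - 1) * max e m := Nat.mul_le_mul (by omega) le_rfl
  · have hb : b ∈ starts := hstart.resolve_left hbq
    have hmem : cval m b ∈ (starts.filter (fun c => q < c)).map (cval m) :=
      List.mem_map.mpr ⟨b, List.mem_filter.mpr ⟨hb, by simp; omega⟩, rfl⟩
    calc Dmin q m ≤ cval m b := foldr_min_le_mem _ _ hmem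
      _ = (b - 1) * max e m := by rw [cval, hEb]
      _ ≤ (p - 1) * max e m := Nat.mul_le_mul (by omega) le_rfl

/-- MAIN BOUND ON ONE TERM: for `p ≥ q ≥ 5`, `(p-1) · max (E p) m ≥ Dmin q m`. -/
theorem den_ge (q m p : ℕ) (hq : 5 ≤ q) (hqp : q ≤ p) : Dmin q m ≤ (p - 1) * max (E p) m := by
  have hs : ∀ c, c ∈ starts ↔ c = 6 ∨ c = 8 ∨ c = 14 ∨ c = 32 ∨ c = 174 ∨ c = 30001 := by
    intro c; simp [starts]
  rcases (by omega : p < 6 ∨ (6 ≤ p ∧ p < 8) ∨ (8 ≤ p ∧ p < 14) ∨ (14 ≤ p ∧ p < 32) ∨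
      (32 ≤ p ∧ p < 174) ∨ (174 ≤ p ∧ p < 30001) ∨ 30001 ≤ p) with h | h | h | h | h | h | h
  · -- band [5,6): p = 5 = q
    have hp5 : p = 5 := by omega
    have hq5 : q = 5 := by omega
    subst hp5; subst hq5
    exact den_ge_of_band 5 m 5 5 6 (by decide) (by decide) (fun _ => by decide) le_rfl le_rfl
      (Or.inl le_rfl)
  · have band : ∀ x, 6 ≤ x → x < 8 → E x = 5 := fun x h1 h2 =>
      E_eq_of_band (b := 6) (b' := 8) (e := 5) (by norm_num) (by norm_num) h1 h2 (by omega)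
    exact den_ge_of_band q m p 6 5 (band p h.1 h.2) (band 6 (by omega) (by omega))
      (fun hb => band q hb (by omega)) h.1 hqp (Or.inr ((hs 6).mpr (by omega)))
  · have band : ∀ x, 8 ≤ x → x < 14 → E x = 4 := fun x h1 h2 =>
      E_eq_of_band (b := 8) (b' := 14) (e := 4) (by norm_num) (by norm_num) h1 h2 (by omega)
    exact den_ge_of_band q m p 8 4 (band p h.1 h.2) (band 8 (by omega) (by omega))
      (fun hb => band q hb (by omega)) h.1 hqp (Or.inr ((hs 8).mpr (by omega)))
  · have band : ∀ x, 14 ≤ x → x < 32 → E x = 3 := fun x h1 h2 =>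
      E_eq_of_band (b := 14) (b' := 32) (e := 3) (by norm_num) (by norm_num) h1 h2 (by omega)
    exact den_ge_of_band q m p 14 3 (band p h.1 h.2) (band 14 (by omega) (by omega))
      (fun hb => band q hb (by omega)) h.1 hqp (Or.inr ((hs 14).mpr (by omega)))
  · have band : ∀ x, 32 ≤ x → x < 174 → E x = 2 := fun x h1 h2 =>
      E_eq_of_band (b := 32) (b' := 174) (e := 2) (by norm_num) (by norm_num) h1 h2 (by omega)
    exact den_ge_of_band q m p 32 2 (band p h.1 h.2) (band 32 (by omega) (by omega))
      (fun hb => band q hb (by omega)) h.1 hqp (Or.inr ((hs 32).mpr (by omega)))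
  · have band : ∀ x, 174 ≤ x → x < 30001 → E x = 1 := fun x h1 h2 =>
      E_eq_of_band (b := 174) (b' := 30001) (e := 1) (by norm_num) (by norm_num) h1 h2 (by omega)
    exact den_ge_of_band q m p 174 1 (band p h.1 h.2) (band 174 (by omega) (by omega))
      (fun hb => band q hb (by omega)) h.1 hqp (Or.inr ((hs 174).mpr (by omega)))
  · exact den_ge_of_band q m p 30001 0 (E_eq_zero h) (E_eq_zero le_rfl)
      (fun hb => E_eq_zero hb) h hqp (Or.inr ((hs 30001).mpr (by omega)))

/-- the rational table: `∑_{i<k} 6 / Dmin (qt i) (k-i)`. -/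
def bnd (k : ℕ) : ℚ := ((List.range k).map (fun i => (6 : ℚ) / Dmin (qt i) (k - i))).sum

/-- FINITE TABLE (kernel evaluation): the bound is `< 1` for `0 < k < 24`
(its maximum is `0.98995…` at `k = 6`). -/
theorem bnd_lt_one : ∀ k, k < 24 → 0 < k → bnd k < 1 := by decide +kernel

/-- `bnd k` cast to `ℝ` is the sum `Σ_{i<k} 6 / Dmin(qt i, k − i)` -/
theorem bnd_cast (k : ℕ) :
    (bnd k : ℝ) = ∑ i ∈ range k, (6 : ℝ) / (Dmin (qt i) (k - i) : ℝ) := by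
  rw [sum_range_eq_list, bnd]
  induction (List.range k) with
  | nil => simp
  | cons x l ih =>
      simp only [List.map_cons, List.sum_cons, Rat.cast_add] at *
      rw [ih]; push_cast; ring

/-! ## §2 The many-factor regime: partial fractions and the harmonic bound -/

/-- `log x ≤ x/32 + 2.4658` for `x > 0` -/
theorem log_le_lin (x : ℝ) (hx : 0 < x) : Real.log x ≤ x / 32 + 2.4658 := by
  have h1 : Real.log (x / 32) ≤ x / 32 - 1 := Real.log_le_sub_one_of_pos (by positivity)
  have h2 : Real.log (x / 32) = Real.log x - Real.log 32 := Real.log_div (ne_of_gt hx) (by norm_num)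
  have h3 : Real.log 32 = 5 * Real.log 2 := by
    rw [show (32 : ℝ) = 2 ^ 5 by norm_num, Real.log_pow]; norm_num
  have h4 := Real.log_two_lt_d9
  linarith

/-- `∑_{i<k} 3 / ((i+2)(k-i)) < 1` for `k ≥ 24`. -/
theorem many_factor_sum (k : ℕ) (hk : 24 ≤ k) :
    ∑ i ∈ range k, (3 : ℝ) / (((i : ℝ) + 2) * ((k : ℝ) - i)) < 1 := by
  have hk0 : (0 : ℝ) < (k : ℝ) + 2 := by positivity
  -- partial fractions
  have hpf : ∀ i ∈ range k, (3 : ℝ) / (((i : ℝ) + 2) * ((k : ℝ) - i)) =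
      3 / ((k : ℝ) + 2) * (1 / ((i : ℝ) + 2) + 1 / ((k : ℝ) - i)) := by
    intro i hi
    have hik : (i : ℝ) < k := by exact_mod_cast mem_range.mp hi
    have h1 : ((k : ℝ) - i) ≠ 0 := by linarith
    have h2 : ((i : ℝ) + 2) ≠ 0 := by positivity
    field_simp
    ring
  rw [sum_congr rfl hpf, ← mul_sum, sum_add_distrib]
  -- the two harmonic pieces
  have hA : ∑ i ∈ range k, (1 : ℝ) / ((i : ℝ) + 2) ≤ Real.log ((k : ℝ) + 1) := by
    have := harmonic_cast_le (k + 1)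
    rw [Finset.sum_range_succ'] at this
    push_cast at this
    have e : ∑ i ∈ range k, (1 : ℝ) / ((i : ℝ) + 2) = ∑ i ∈ range k, (1 : ℝ) / (((i : ℝ) + 1) + 1) :=
      sum_congr rfl (fun i _ => by ring)
    rw [e]; linarith
  have hB : ∑ i ∈ range k, (1 : ℝ) / ((k : ℝ) - i) ≤ 1 + Real.log ((k : ℝ) + 1) := by
    have href : ∑ i ∈ range k, (1 : ℝ) / ((k : ℝ) - i) = ∑ j ∈ range k, (1 : ℝ) / ((j : ℝ) + 1) := by
      rw [← Finset.sum_range_reflect (fun j => (1 : ℝ) / ((j : ℝ) + 1)) k]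
      apply sum_congr rfl
      intro i hi
      have hik : i < k := mem_range.mp hi
      have : ((k - 1 - i : ℕ) : ℝ) = (k : ℝ) - 1 - i := by
        rw [Nat.cast_sub (by omega), Nat.cast_sub (by omega)]; push_cast; ring
      rw [this]; ring
    rw [href]
    have h1 := harmonic_cast_le k
    have h2 : Real.log (k : ℝ) ≤ Real.log ((k : ℝ) + 1) :=
      Real.log_le_log (by exact_mod_cast (show 0 < k by omega)) (by linarith)
    linarith
  have hlog := log_le_lin ((k : ℝ) + 1) (by positivity)
  have hk' : (24 : ℝ) ≤ k := by exact_mod_cast hk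
  rw [div_mul_eq_mul_div, div_lt_one hk0]
  nlinarith


end HodgeFermat.KRFree.HypUTailQ
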